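import Mathlib
import Summits.Ventures.PercRepro.TriangleCapThreeRowSecondBest

/-!
# PercRepro — THE SECOND-BEST CHERRY COUNT OF THE ROW `a = 3` IN THE TABLE'S COORDINATES (p3, gen 43; part 193)

Part 192 in the cherry form of `closed_form_exact_k4m`: on the cell `(k, 3, r)`, `r ≥ 1`, `k ≥ r + 7` — the edge
count `m = 3 (k − 3) − r` — every `K₄⁻`-free graph on `Fin k` with `m` edges that is not extremal
(`2·cherries + r (k − 1 − r) ≠ m (k − 2)`) has `2·cherries D + r (k − 1 − r) + secondGapThree k r ≤ m (k − 2)`,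
and the bound is attained (`cherry_table_second_best_three`). Through `2·cherries + Σ d = Σ d²` and `Σ d = 2m`.
Axioms: standard.
-/

namespace PercRepro

namespace TriangleCap

namespace C047

open Finset

variable {V : Type*} [Fintype V] [DecidableEq V]

omit [DecidableEq V] in
/-- `Σ d² + X ≤ m k ↔ 2·cherries + X ≤ m (k − 2)` on a graph with `m` edges and `k ≥ 2` vertices. -/
theorem sum_deg_sq_le_iff_cherries (D : SimpleGraph V) [DecidableRel D.Adj] (X : ℕ) (hk : 2 ≤ Fintype.card V) :
    ∑ v, deg D v * deg D v + X ≤ D.edgeFinset.card * Fintype.card V ↔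
      2 * cherries D + X ≤ D.edgeFinset.card * (Fintype.card V - 2) := by
  have h1 := two_mul_cherries_add D
  have h2 := sum_deg_eq D
  obtain ⟨t, ht⟩ : ∃ t, Fintype.card V = t + 2 := ⟨Fintype.card V - 2, by omega⟩
  rw [ht, Nat.add_sub_cancel]
  constructor
  · intro h
    nlinarith [h, h1, h2]
  · intro h
    nlinarith [h, h1, h2]

omit [DecidableEq V] in
/-- `Σ d² + X = m k ↔ 2·cherries + X = m (k − 2)`. -/
theorem sum_deg_sq_eq_iff_cherries (D : SimpleGraph V) [DecidableRel D.Adj] (X : ℕ) (hk : 2 ≤ Fintype.card V) :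
    ∑ v, deg D v * deg D v + X = D.edgeFinset.card * Fintype.card V ↔
      2 * cherries D + X = D.edgeFinset.card * (Fintype.card V - 2) := by
  have h1 := two_mul_cherries_add D
  have h2 := sum_deg_eq D
  obtain ⟨t, ht⟩ : ∃ t, Fintype.card V = t + 2 := ⟨Fintype.card V - 2, by omega⟩
  rw [ht, Nat.add_sub_cancel]
  constructor
  · intro h
    nlinarith [h, h1, h2]
  · intro h
    nlinarith [h, h1, h2]

/-- **THE SECOND-BEST CHERRY COUNT OF THE ROW `a = 3`:** on the cell `(k, 3, r)`, `r ≥ 1`, `k ≥ r + 7`, every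
non-extremal `K₄⁻`-free graph on `Fin k` with `3 (k − 3) − r` edges has
`2·cherries D + r (k − 1 − r) + secondGapThree k r ≤ (3 (k − 3) − r) (k − 2)`, and the value is attained. -/
theorem cherry_table_second_best_three (k r : ℕ) (hr : 1 ≤ r) (hk : r + 7 ≤ k) :
    (∀ (D : SimpleGraph (Fin k)) [DecidableRel D.Adj], K4mFree D → D.edgeFinset.card = 3 * (k - 3) - r →
        2 * cherries D + r * (k - 1 - r) ≠ (3 * (k - 3) - r) * (k - 2) →
        2 * cherries D + r * (k - 1 - r) + secondGapThree k r ≤ (3 * (k - 3) - r) * (k - 2)) ∧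
      ∃ (D : SimpleGraph (Fin k)) (_ : DecidableRel D.Adj), K4mFree D ∧ D.edgeFinset.card = 3 * (k - 3) - r ∧
        2 * cherries D + r * (k - 1 - r) + secondGapThree k r = (3 * (k - 3) - r) * (k - 2) := by
  obtain ⟨hbound, D, hD, hK, hm, hS⟩ := three_row_second_best k r hr hk
  have hcard : Fintype.card (Fin k) = k := Fintype.card_fin k
  refine ⟨?_, ⟨D, hD, hK, by omega, ?_⟩⟩
  · intro D' _ hK' hm' hne
    have hm'' : D'.edgeFinset.card + 9 + r = 3 * k := by omega
    have hne' : ∑ v, deg D' v * deg D' v + r * (k - 1 - r) ≠ D'.edgeFinset.card * k := by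
      intro h
      apply hne
      rw [← hm']
      have := (sum_deg_sq_eq_iff_cherries D' (r * (k - 1 - r)) (by rw [hcard]; omega)).mp (by rw [hcard]; exact h)
      rw [hcard] at this
      exact this
    have h := hbound D' hK' hm'' hne'
    rw [add_assoc] at h
    have := (sum_deg_sq_le_iff_cherries D' (r * (k - 1 - r) + secondGapThree k r) (by rw [hcard]; omega)).mp
      (by rw [hcard]; exact h)
    rw [hcard, hm', ← add_assoc] at this
    exact this
  · rw [add_assoc] at hS
    have := (sum_deg_sq_eq_iff_cherries D (r * (k - 1 - r) + secondGapThree k r) (by rw [hcard]; omega)).mp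
      (by rw [hcard]; exact hS)
    rw [hcard] at this
    have hm' : D.edgeFinset.card = 3 * (k - 3) - r := by omega
    rw [hm', ← add_assoc] at this
    exact this

end C047

end TriangleCap

end PercRepro
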